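import Summits.BirchSwinnertonDyer.BirchSwinnertonDyer.Theorems.ResidualThetaTransportAtTwoResidualSignedLambdaLowerCMAtTwoStationRCoeffEmbeddings
import HarnessLib

/-!
# Station (R) of line `onepair` (crux RSL_g, stmt-BirchSwinnertonDyer-22608) — file R3a: the TRANSFER STEP in Frobenius coordinates
# (`Σ_i ε_i · Σ_l t₀(c′_i bO_l) W_l = δ · (Σ_i c′_i ε_i) · Σ_l bO_l W_l` from the `𝒪`-equivariance of the recombined values)

Route `ResidualThetaTransportAtTwo` (RTT), crux `ResidualSignedLambdaLowerCMAtTwo` (stmt-BirchSwinnertonDyer-22608), line `onepair` v3f, station (R)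
`stub_kzgValueRelation`. Seat `bsd-wall-tp2-p2x-w3` g18 (width seat; helper, `--supports … --as helper`, closes nothing). THEOREMS ONLY (no definition,
no instance, no notation, no `sorry`); PURE ALGEBRA over the `p`-adic coefficient field. BSD is not proved by anything here; 22608 / 26074 / 24105 OPEN / HOLD.

WHAT (memo `STATION-R-PORT-w3g18.md`, evidence #54 on 22608, step C of finding F2). In the (R) stub the trivialisation `e` enters the values of
`e(P⃗_{2m}((C y)•z))` only through `ε_i := ι_Λ(e δ_i)(ζ−1) ∈ ℂ_p`, and (BKρ) + Kobayashi's dictionary give the coordinate values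
`P⃗((C y)•z)_i(ζ_ψ−1) = G · Σ_l t₀(c′_i · y · bO_l) · W_l` (`G = 3 g(ψ)`, `W_l` the Galois-twisted value sums). The second (E)-clause `hlin` of the
stub (with the column congruence) makes `y ↦ Σ_i ε_i P⃗((C y)•z)_i(ζ−1)` equal to `y · Σ_i ε_i P⃗(z)_i(ζ−1)` on `𝒪`. THIS FILE turns that
`𝒪`-equivariance into the closed formula
  `Σ_i ε_i · (G Σ_l t₀(c′_i bO_l) W_l) = G · δ · (Σ_i c′_i ε_i) · (Σ_l bO_l W_l)`, `δ` = the trace dual of `t₀` (`t₀ = Tr_{K/ℚ_p}(δ ·)` on `𝒪`),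
(`sum_mul_values_eq_of_equivariant`) — R1's Dedekind TRANSFER applied to the `ℚ_p`-linear extension of `y ↦ Σ_i ε_i t₀(c′_i y)`, whose coefficient along
an embedding `σ` is `Σ_i ε_i σ(δ c′_i)`. Also: the trace dual of a non-zero `t₀` is non-zero (`traceDual_ne_zero`). Nothing about curves or forms.

References: [Lang2002] Ch. VI §4 Thm. 4.1, §5 Cor. 5.3; [Kato2004Asterisque] Thm. 12.5 (1) (p. 221) and §14.9 (p. 239) (the Frobenius coordinates
`t₀, c′, bO` of the one-pair pins are Kato's).
-/

set_option autoImplicit false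
-- D-0017: single-problem summit, so `Summit.BirchSwinnertonDyer.BirchSwinnertonDyer.…` repeats a namespace BY DESIGN.
set_option linter.dupNamespace false

noncomputable section

open scoped Classical
open Module Literature.NumberTheory.EllipticCurves

namespace Summit.BirchSwinnertonDyer.BirchSwinnertonDyer.Theorems.ThetaTransport.StationR

variable {p : ℕ} [Fact p.Prime] (S : Set (PadicAlgCl p)) [FiniteDimensional ℚ_[p] (padicCoeffField S)]

/-- **The trace dual of the Frobenius datum.** A `ℤ_p`-linear `t₀ : 𝒪 → ℤ_p` is `Tr_{K/ℚ_p}(δ ·)` on `𝒪` for a (unique) `δ ∈ K = ℚ_p(S)`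
(extend `t₀` to `K = 𝒪[1/p]`, then take the trace dual). [cite: Lang2002, Ch. VI §5 Cor. 5.3] -/
theorem exists_trace_mul_eq_padicInt (t₀ : padicCoeffIntegers S →+ ℤ_[p])
    (ht₀ : ∀ (c : ℤ_[p]) (a : padicCoeffIntegers S), t₀ (padicIntToCoeffIntegers S c * a) = c * t₀ a) :
    ∃ (t : padicCoeffField S →ₗ[ℚ_[p]] ℚ_[p]) (δ : padicCoeffField S),
      (∀ a : padicCoeffIntegers S, t (padicCoeffIntegers.toField S a) = (t₀ a : ℚ_[p])) ∧
      ∀ y : padicCoeffField S, Algebra.trace ℚ_[p] (padicCoeffField S) (δ * y) = t y := by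
  obtain ⟨t, ht⟩ := exists_linearMap_extend S (V := ℚ_[p]) ((PadicInt.Coe.ringHom : ℤ_[p] →+* ℚ_[p]).toAddMonoidHom.comp t₀)
    (fun c a => by
      simp only [AddMonoidHom.coe_comp, Function.comp_apply, RingHom.toAddMonoidHom_eq_coe, AddMonoidHom.coe_coe, ht₀, map_mul,
        smul_eq_mul]
      rfl)
  obtain ⟨δ, hδ, -⟩ := existsUnique_trace_mul_eq t
  exact ⟨t, δ, fun a => by rw [ht]; rfl, hδ⟩

omit [FiniteDimensional ℚ_[p] (padicCoeffField S)] in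
/-- **Non-vanishing of the trace dual**: if `t₀ ≠ 0` then `δ ≠ 0`. [cite: Lang2002, Ch. VI §5 Cor. 5.3] -/
theorem traceDual_ne_zero (t₀ : padicCoeffIntegers S →+ ℤ_[p]) (t : padicCoeffField S →ₗ[ℚ_[p]] ℚ_[p]) (δ : padicCoeffField S)
    (ht : ∀ a : padicCoeffIntegers S, t (padicCoeffIntegers.toField S a) = (t₀ a : ℚ_[p]))
    (hδ : ∀ y : padicCoeffField S, Algebra.trace ℚ_[p] (padicCoeffField S) (δ * y) = t y) (h0 : t₀ ≠ 0) : δ ≠ 0 := by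
  intro hz
  apply h0
  ext a
  have h1 := hδ (padicCoeffIntegers.toField S a)
  rw [hz, zero_mul, map_zero, ht] at h1
  rw [AddMonoidHom.zero_apply]
  exact PadicInt.coe_eq_zero.mp h1.symm

set_option maxHeartbeats 400000 in
/-- **TRANSFER in Frobenius coordinates (step C of the (R) port).** Data: the Frobenius functional `t₀ : 𝒪 → ℤ_p` (`ℤ_p`-linear) with trace
dual `δ` (`Tr(δ a) = t₀ a` on `𝒪`), coordinates `c′_i ∈ 𝒪` (`i < n`), a recombination family `bO_l ∈ 𝒪`, values `ε_i, W_l, G ∈ ℂ_p`. HYPOTHESIS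
(`𝒪`-equivariance of the recombined values, = `hlin` read through (BKρ)): for every `a ∈ 𝒪`,
`Σ_i ε_i · (G Σ_l t₀(c′_i a bO_l) W_l) = a · Σ_i ε_i · (G Σ_l t₀(c′_i bO_l) W_l)`. CONCLUSION:
`Σ_i ε_i · (G Σ_l t₀(c′_i bO_l) W_l) = G · δ · (Σ_i c′_i ε_i) · (Σ_l bO_l W_l)` — only the identity-embedding component of the value vector survives
(R1 `sum_mul_eq_coeff_mul_sum` for `f = Σ_i ε_i · Tr(δ c′_i ·) = Σ_σ (Σ_i ε_i σ(δ c′_i)) σ`). [cite: Lang2002, Ch. VI §4 Thm. 4.1]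
[cite: Kato2004Asterisque, Thm. 12.5 (1) (p. 221), §14.9 (p. 239)] -/
theorem sum_mul_values_eq_of_equivariant {n nb : ℕ} (t₀ : padicCoeffIntegers S →+ ℤ_[p])
    (t : padicCoeffField S →ₗ[ℚ_[p]] ℚ_[p]) (δ : padicCoeffField S)
    (ht : ∀ a : padicCoeffIntegers S, t (padicCoeffIntegers.toField S a) = (t₀ a : ℚ_[p]))
    (hδ : ∀ y : padicCoeffField S, Algebra.trace ℚ_[p] (padicCoeffField S) (δ * y) = t y)
    (c' : Fin n → padicCoeffIntegers S) (bO : Fin nb → padicCoeffIntegers S) (ε : Fin n → ℂ_[p]) (W : Fin nb → ℂ_[p]) (G : ℂ_[p])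
    (hLin : ∀ a : padicCoeffIntegers S,
      ∑ i, ε i * (G * ∑ l, algebraMap ℚ_[p] ℂ_[p] (t₀ (c' i * a * bO l) : ℚ_[p]) * W l) =
        algebraMap (PadicAlgCl p) ℂ_[p] (a : PadicAlgCl p) * ∑ i, ε i * (G * ∑ l, algebraMap ℚ_[p] ℂ_[p] (t₀ (c' i * bO l) : ℚ_[p]) * W l)) :
    ∑ i, ε i * (G * ∑ l, algebraMap ℚ_[p] ℂ_[p] (t₀ (c' i * bO l) : ℚ_[p]) * W l) =
      G * algebraMap (PadicAlgCl p) ℂ_[p] (δ : PadicAlgCl p) * (∑ i, algebraMap (PadicAlgCl p) ℂ_[p] (c' i : PadicAlgCl p) * ε i) *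
        ∑ l, algebraMap (PadicAlgCl p) ℂ_[p] (bO l : PadicAlgCl p) * W l := by
  set ι₀ : padicCoeffField S →ₐ[ℚ_[p]] ℂ_[p] := (IsScalarTower.toAlgHom ℚ_[p] (PadicAlgCl p) ℂ_[p]).comp (padicCoeffField S).val
    with hι₀def
  have hι₀ : ∀ y : padicCoeffField S, ι₀ y = algebraMap (PadicAlgCl p) ℂ_[p] (y : PadicAlgCl p) := fun y => rfl
  have halg : ∀ r : ℚ_[p], algebraMap ℚ_[p] ℂ_[p] r = algebraMap (PadicAlgCl p) ℂ_[p] (algebraMap ℚ_[p] (PadicAlgCl p) r) :=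
    fun r => IsScalarTower.algebraMap_apply ℚ_[p] (PadicAlgCl p) ℂ_[p] r
  -- the functional `f y = Σ_i ε_i · t(c′_i y)` read in `ℂ_p`
  set f : padicCoeffField S →ₗ[ℚ_[p]] ℂ_[p] :=
    ∑ i, ε i • ((Algebra.linearMap ℚ_[p] ℂ_[p]).comp (t.comp (LinearMap.mulLeft ℚ_[p] (padicCoeffIntegers.toField S (c' i)))))
    with hfdef
  have hf : ∀ y, f y = ∑ i, ε i * algebraMap ℚ_[p] ℂ_[p] (t (padicCoeffIntegers.toField S (c' i) * y)) := by
    intro y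
    simp only [hfdef, LinearMap.coe_sum, Finset.sum_apply, LinearMap.smul_apply, LinearMap.comp_apply, Algebra.linearMap_apply,
      LinearMap.mulLeft_apply, smul_eq_mul]
  -- its values on `𝒪`-products
  have hfO : ∀ a b : padicCoeffIntegers S, f (padicCoeffIntegers.toField S a * padicCoeffIntegers.toField S b) =
      ∑ i, ε i * algebraMap ℚ_[p] ℂ_[p] (t₀ (c' i * a * b) : ℚ_[p]) := by
    intro a b
    rw [hf]
    refine Finset.sum_congr rfl fun i _ => ?_
    rw [← mul_assoc, ← map_mul, ← map_mul, ht]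
  -- its Dedekind coefficients: `a_σ = Σ_i ε_i σ(δ c′_i)`
  have ha : ∀ y, f y = ∑ σ : padicCoeffField S →ₐ[ℚ_[p]] ℂ_[p], (∑ i, ε i * σ (δ * padicCoeffIntegers.toField S (c' i))) * σ y := by
    intro y
    rw [hf]
    have hi : ∀ i, algebraMap ℚ_[p] ℂ_[p] (t (padicCoeffIntegers.toField S (c' i) * y)) =
        ∑ σ : padicCoeffField S →ₐ[ℚ_[p]] ℂ_[p], σ (δ * padicCoeffIntegers.toField S (c' i)) * σ y := by
      intro i
      have hδ' : ∀ y', Algebra.trace ℚ_[p] (padicCoeffField S) ((δ * padicCoeffIntegers.toField S (c' i)) * y') =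
          (t.comp (LinearMap.mulLeft ℚ_[p] (padicCoeffIntegers.toField S (c' i)))) y' := by
        intro y'
        rw [LinearMap.comp_apply, LinearMap.mulLeft_apply, ← hδ, mul_assoc]
      have := algebraMap_apply_eq_sum_of_trace_mul_eq (L := ℂ_[p]) _ _ hδ' y
      rwa [LinearMap.comp_apply, LinearMap.mulLeft_apply] at this
    simp_rw [hi, Finset.mul_sum]
    rw [Finset.sum_comm]
    refine Finset.sum_congr rfl fun σ _ => ?_
    rw [Finset.sum_mul]
    refine Finset.sum_congr rfl fun i _ => ?_
    ring
  -- the equivariance on all of `K` (both sides are `ℚ_p`-linear in `y` and agree on `𝒪`)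
  set C : ℂ_[p] := ∑ l, f (padicCoeffIntegers.toField S (bO l)) * (G * W l) with hCdef
  have hequiv : ∀ y : padicCoeffField S,
      ∑ l, f (y * padicCoeffIntegers.toField S (bO l)) * (G * W l) = ι₀ y * C := by
    -- as linear maps
    set Lhs : padicCoeffField S →ₗ[ℚ_[p]] ℂ_[p] :=
      ∑ l, (G * W l) • (f.comp (LinearMap.mulRight ℚ_[p] (padicCoeffIntegers.toField S (bO l)))) with hLdef
    set Rhs : padicCoeffField S →ₗ[ℚ_[p]] ℂ_[p] := C • ι₀.toLinearMap with hRdef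
    have hL : ∀ y, Lhs y = ∑ l, f (y * padicCoeffIntegers.toField S (bO l)) * (G * W l) := by
      intro y
      simp only [hLdef, LinearMap.coe_sum, Finset.sum_apply, LinearMap.smul_apply, LinearMap.comp_apply, LinearMap.mulRight_apply,
        smul_eq_mul]
      refine Finset.sum_congr rfl fun l _ => ?_
      ring
    have hR : ∀ y, Rhs y = ι₀ y * C := by
      intro y
      simp only [hRdef, LinearMap.smul_apply, AlgHom.toLinearMap_apply, smul_eq_mul, mul_comm]
    have hLR : Lhs = Rhs := by
      refine linearMap_ext_of_padicCoeffIntegers S Lhs Rhs fun a => ?_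
      rw [hL, hR, hι₀]
      -- on `𝒪` this is `hLin`
      have h1 : ∑ l, f (padicCoeffIntegers.toField S a * padicCoeffIntegers.toField S (bO l)) * (G * W l) =
          ∑ i, ε i * (G * ∑ l, algebraMap ℚ_[p] ℂ_[p] (t₀ (c' i * a * bO l) : ℚ_[p]) * W l) := by
        simp_rw [hfO, Finset.sum_mul, Finset.mul_sum]
        rw [Finset.sum_comm]
        refine Finset.sum_congr rfl fun i _ => ?_
        refine Finset.sum_congr rfl fun l _ => ?_
        ring
      have h2 : C = ∑ i, ε i * (G * ∑ l, algebraMap ℚ_[p] ℂ_[p] (t₀ (c' i * bO l) : ℚ_[p]) * W l) := by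
        rw [hCdef]
        have hfO1 : ∀ b : padicCoeffIntegers S, f (padicCoeffIntegers.toField S b) =
            ∑ i, ε i * algebraMap ℚ_[p] ℂ_[p] (t₀ (c' i * b) : ℚ_[p]) := by
          intro b
          have := hfO 1 b
          simp only [map_one, one_mul, mul_one] at this
          exact this
        simp_rw [hfO1, Finset.sum_mul, Finset.mul_sum]
        rw [Finset.sum_comm]
        refine Finset.sum_congr rfl fun i _ => ?_
        refine Finset.sum_congr rfl fun l _ => ?_
        ring
      rw [h1, h2]
      exact hLin a
    intro y
    rw [← hL, ← hR, hLR]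
  -- R1's transfer
  have hT := sum_mul_eq_coeff_mul_sum ι₀ f _ ha (fun l => padicCoeffIntegers.toField S (bO l)) (fun l => G * W l) hequiv
  -- rewrite both sides
  have hlhs : ∑ l, f (padicCoeffIntegers.toField S (bO l)) * (G * W l) =
      ∑ i, ε i * (G * ∑ l, algebraMap ℚ_[p] ℂ_[p] (t₀ (c' i * bO l) : ℚ_[p]) * W l) := by
    have hfO1 : ∀ b : padicCoeffIntegers S, f (padicCoeffIntegers.toField S b) =
        ∑ i, ε i * algebraMap ℚ_[p] ℂ_[p] (t₀ (c' i * b) : ℚ_[p]) := by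
      intro b
      have := hfO 1 b
      simp only [map_one, one_mul, mul_one] at this
      exact this
    simp_rw [hfO1, Finset.sum_mul, Finset.mul_sum]
    rw [Finset.sum_comm]
    refine Finset.sum_congr rfl fun i _ => ?_
    refine Finset.sum_congr rfl fun l _ => ?_
    ring
  rw [← hlhs, hT]
  have e1 : ∀ i, ι₀ (δ * padicCoeffIntegers.toField S (c' i)) =
      algebraMap (PadicAlgCl p) ℂ_[p] (δ : PadicAlgCl p) * algebraMap (PadicAlgCl p) ℂ_[p] (c' i : PadicAlgCl p) := by
    intro i; rw [hι₀, ← map_mul]; rfl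
  have e2 : ∀ l, ι₀ (padicCoeffIntegers.toField S (bO l)) = algebraMap (PadicAlgCl p) ℂ_[p] (bO l : PadicAlgCl p) := by
    intro l; rw [hι₀]; rfl
  simp only [e1, e2, Finset.sum_mul, Finset.mul_sum]
  refine Finset.sum_congr rfl fun l _ => ?_
  refine Finset.sum_congr rfl fun i _ => ?_
  ring

end Summit.BirchSwinnertonDyer.BirchSwinnertonDyer.Theorems.ThetaTransport.StationR

end
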